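/-
Copyright (c) 2026 the pub-hodgecm-mathlib formalisation cell (harness21).  Prover seat hodgecm-mathlib-LH4-p07 (g5): Track A «(D-RAM) FOUR-FRAME» squad of crux H413, unit
U3_Laws, (KMS) road «MODULO κ-STAGE B», brick κB-H₂ «CORE-HANGING κ AT TYPE 2, CLASS SIDE», FILE (A1₂) (dealer LH4-plan (g11) WORD #55 (2); letter of record LH4-p06 (g3)
`LETTER-kappaBH-tv2.v1.LH4p06g3.md` 44d44a13 §1, κ owner LH4-p05 (g3) «=» 2026-09-04T02:22:07Z), 2026-09-04.
-/
import Summits.HodgeConjecture.HodgeConjecture.Theorems.F0P3cDyRamDiagonalCoreHangingPolarisationCountTypeTwo  -- ★ p856523 (iii)₂(b) (this lineage, g4): `explicit_polarisation`; brings (ii)₂ `exists_mem_fixedUnitStabilizer_iff_v_sub_le` ∕ `letters_and_v_of_mem_Delta2`, ★ p13 `polarisationCosets_eq_image_of_reps` ∕ `mem_coset_self`, ★ `isVertexLattice_diagonal_mul_of_mem_fixedUnitStabilizer`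
import Summits.HodgeConjecture.HodgeConjecture.Theorems.F0P3cDyRamDiagonalKappaCountEval                      -- ★ Fκ2 (LH4-p05 (g3)): `cosetKappa_coset_eq_of_forall`, `cosetKappa_coset_eq_zero_of_exists`, `chiVec_eq`; brings ★ Fκ1 `kappaCount`, `cosetKappa`, `chiVec`, ★ `normSign_mul_norm`
import HarnessLib

/-!
# Crux `H413`, (KMS) ROAD «MODULO κ-STAGE B», brick κB-H₂ FILE (A1₂): THE TYPE-2 κ-COUNT OF A CORE-HANGING FRAME LATTICE AS A SUM OVER ITS `n₂(ρ)` POLARISATION CLASSES —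
# `kappaCount σ ϖ 2 i (latt V₂) = Σ_{φ ∈ R₀} cosetKappa σ i (D(φ)·S_F)`, with the ω∕χ-TABLE of the explicit polarisation `D(φ)` at the exact invariant

Cell `hodgecm-mathlib` (D-0151), FLOOR 0, crux item H413 = `stmt-HodgeConjecture-24833`; lane `--supports stmt-HodgeConjecture-24833 --as helper` (count-neutral).  THEOREMS ONLY
(no `def`, no instance, no notation, no `sorry`, default heartbeats).  Letter of record: LH4-p06 (g3) `LETTER-kappaBH-tv2.v1` 44d44a13 §1 (the cosets and their forms); this file
is the type-2 twin of p06's FILE (A1) `…CoreHangingPolarisationExplicit` (one coset at `tv = 0`; `n₂(ρ) = q^{(ρ+2)∕2 − (ρ+1)∕2}` cosets here, ★ (iii)₂(b)).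

THE MATHEMATICS.  `V₂ = (1 0 0; x ϖ^ρ 0; xζ+y″ ϖ^ρζ ϖ^{2ρ+1})`, `ρ ≥ 1`, `x, ζ, y″, xζ+y″` units.  ★ (iii)₂(b) `polarisationCount_two_latt_coreHanging_eq` ENUMERATED the
`S_F(latt V₂)`-classes of type-2 polarisations: with `R` a complete irredundant system of `σ`-fixed units modulo `𝔭^{ρ+1}` and `R₀ = {φ ∈ R : |φ − f₀| ≤ |ϖ|^ρ}` (`f₀` any fixed
lineariser with (R) `|ζσy″ − σx·f₀| ≤ |ϖ|^ρ`), the classes are those of the explicit forms `D(φ) = (D₀(φ), D₁(φ), P)`, `P = (ϖσϖ)^{−ρ}`, `D₁(φ) = −P(ζσζ + φ)`,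
`D₀(φ) = P·φ° − (σx·D₁(φ)·x + σy·P·y)`, `φ° = −B_φ B′_φ∕φ` (★ `explicit_polarisation`), `φ ∈ R₀`, pairwise unrelated ((ii)₂: related ⟺ letters agree modulo `𝔭^{ρ+1}`).
* §0 (generic, any `tv`): `kappaCount_eq_zero_of_exists_mem_fixedUnitStabilizer` — ONE `u₀ ∈ S_F(M)` with `χ_i(u₀) ≠ 1` kills `kappaCount σ ϖ tv i M` (every coset carries both
  signs, ★ Fκ2), however many cosets there are; `kappaCount_eq_sum_cosetKappa_of_reps` — the ★ p13 letters `hΔ`∕`hfree` turn `kappaCount` into a `Finset.sum` of `cosetKappa` over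
  the representatives (`finsum` over the image of an injective coset map).
* §1 THE TABLES at the EXACT INVARIANT `y″ = f·xζ` (`f` a fixed unit, `|1+f| = 1`; every orbit member has this shape, ★ (A)): `D₀(φ) = P·Nx·h̃(φ)` with
  `h̃(φ) = (φ − fNζ(2+f)) − (fNζ − φ)²∕φ` (`N = (·)σ(·)`), so `(ω(D₀), ω(D₁), ω(P)) = (ω(h̃ φ), ω(−(Nζ+φ)), 1)` and
  `(χ_0, χ_1, χ_2)(D(φ)) = (ω(−(Nζ+φ)), ω(h̃ φ), ω(h̃ φ)·ω(−(Nζ+φ)))`; near letters `|−(Nζ+φ) + Nζ(1+f)| = |φ − fNζ|`, `|h̃(φ) − h(φ)| ≤ |ϖ|^{2ρ}` (`h(φ) = φ − fNζ(2+f)`),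
  `h(φ) + fNζ(1+f) = φ − fNζ`.
* §2 `kappaCount_two_latt_coreHanging_eq_sum_cosetKappa` (general `y″`, the (iii)₂(b) enumeration re-run with `cosetKappa` in place of `1`) and, at the exact invariant with the
  window ALIVE (`χ_i ≡ 1` on `S_F`), `kappaCount_two_latt_coreHanging_eq_finsum_table`: `kappaCount σ ϖ 2 i (latt V₂) = Σᶠ_{φ ∈ R₀} (table above)_i`.  FILE (A2₂)
  `…KappaCoreHangingTwoClass` evaluates the window and the three character sums (regimes `ρ ≥ 2d−1` ∕ `ρ = 2d−2` ∕ `ρ ≤ 2d−3`) and states the per-class HEAD.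
HONEST LABEL.  Count-neutral; `HC_CM` is proved only modulo the 7 printed citations (2 remaining named inputs: hLiu418 = `stmt-HodgeConjecture-24832`, h413 = `stmt-HodgeConjecture-24833`)
until rung 0 closes.

## References
* [Kottwitz1986BaseChangeUnits] R. Kottwitz, *Base change for unit elements of Hecke algebras*, Compositio Math. 60 (1986), §1 pp. 240–241 (κ-orbital integrals as signed lattice counts
  modulo the torus).
* [Rogawski1990] J. D. Rogawski, *Automorphic Representations of Unitary Groups in Three Variables*, Ann. of Math. Stud. 123 (1990), §4.9 Prop. 4.9.1 (a) p. 55; §4.10 p. 58.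
* [LanglandsShelstad1987] R. P. Langlands, D. Shelstad, *On the definition of transfer factors*, Math. Ann. 278 (1987), §3 (κ as a character on the classes in a stable class).
* [Jacobowitz1962] R. Jacobowitz, *Hermitian forms over local fields*, Amer. J. Math. 84 (1962), §7 (modular lattices, Gram matrices).
* [Serre1979] J.-P. Serre, *Local Fields*, GTM 67 (1979), Ch. IV §2 Prop. 6; Ch. V §3 (the unit filtration and the norm classes).
-/

set_option autoImplicit false

noncomputable section

namespace Summit.HodgeConjecture.HodgeConjecture.Cruxes.H413.F0P3cDyRamDiagonalKappaCoreHangingTwoForms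

open Matrix
open Literature.NumberTheory.Automorphic Literature.NumberTheory.Automorphic.HermitianLattice Literature.NumberTheory.Automorphic.UnitaryGroup
open Literature.NumberTheory.Automorphic.UnitaryLatticeTree Literature.NumberTheory.Automorphic.UnitaryThreeFourFrame
open Summit.HodgeConjecture.HodgeConjecture.Cruxes.H413.F0P3cDyRamDiagonalTorusDefs
open Summit.HodgeConjecture.HodgeConjecture.Cruxes.H413.F0P3cDyRamDiagonalStrataDefs
open Summit.HodgeConjecture.HodgeConjecture.Cruxes.H413.F0P3cDyRamDiagonalKappaCountDefs
open Summit.HodgeConjecture.HodgeConjecture.Cruxes.H413.F0P3cDyRamDiagonalKappaCountEval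
open Summit.HodgeConjecture.HodgeConjecture.Cruxes.H413.F0P3cDyRamDiagonalGluedStabiliserIndex (ne_zero_and_v_lt_one_of_v_eq_exp)
open Summit.HodgeConjecture.HodgeConjecture.Cruxes.H413.F0P3cDyRamDiagonalPolarisationCoset
open Summit.HodgeConjecture.HodgeConjecture.Cruxes.H413.F0P3cDyRamDiagonalPolarisationCountTools
open Summit.HodgeConjecture.HodgeConjecture.Cruxes.H413.F0P3cDyRamDiagonalGluedClassRepresentatives
open Summit.HodgeConjecture.HodgeConjecture.Cruxes.H413.F0P3cDyRamDiagonalCoreHangingPolarisationClassesTypeTwo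
open Summit.HodgeConjecture.HodgeConjecture.Cruxes.H413.F0P3cDyRamDiagonalCoreHangingPolarisationCountTypeTwo
open Summit.HodgeConjecture.HodgeConjecture.Cruxes.H413.F0P3cDyRamFixedCountDiagonalModel (normSign_mul_norm)
open scoped Valued WithZero Matrix MatrixGroups

variable {K : Type} [Field K]

/-! ## §0  Two generic facts about `kappaCount` (any vertex type, any lattice) -/

section Generic

variable [Valued K ℤᵐ⁰]

/-- **A DEAD SLOT KILLS THE κ-COUNT**: under the index-two dichotomy with a non-norm witness `c`, if some `u₀ ∈ S_F(M)` has `χ_i(u₀) ≠ 1` then EVERY `S_F(M)`-coset of type-`tv`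
polarisations carries both signs (★ Fκ2 `cosetKappa_coset_eq_zero_of_exists`), so `kappaCount σ ϖ tv i M = 0` — whatever the number of cosets.
[cite: Kottwitz1986BaseChangeUnits, §1 pp. 240–241] [cite: LanglandsShelstad1987, §3] -/
theorem kappaCount_eq_zero_of_exists_mem_fixedUnitStabilizer (σ : K →+* K) {c : K} (hσc : σ c = c) (hc : ¬ ∃ z : K, z * σ z = c)
    (hdich : ∀ s : K, σ s = s → s ≠ 0 → (∃ z : K, z * σ z = s) ∨ ∃ z : K, z * σ z = c * s) (ϖ : K) (tv : ℕ) (i : Fin 3)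
    (M : Submodule 𝒪[K] (Fin 3 → K)) (hex : ∃ u₀ ∈ fixedUnitStabilizer σ M, chiVec σ i (fun j => ((u₀ j : Kˣ) : K)) ≠ 1) :
    kappaCount σ ϖ tv i M = 0 := by
  rw [kappaCount_eq]
  refine finsum_mem_of_eqOn_zero fun C hC => ?_
  obtain ⟨D, ⟨hD, -⟩, rfl⟩ := (mem_polarisationCosets_iff σ ϖ tv M C).1 hC
  exact cosetKappa_coset_eq_zero_of_exists σ hσc hc hdich i M hD hex

/-- **THE κ-COUNT AS A SUM OVER FREE REPRESENTATIVES**: if every type-`tv` polarisation of `M` is `S_F(M)`-related to a member of the finite set `reps` of non-degenerate fixed forms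
(`hΔ`) and distinct members are unrelated (`hfree`) — the letters of ★ p13 `polarisationCount_eq_card_of_reps` — then
`kappaCount σ ϖ tv i M = Σ_{D₁ ∈ reps} cosetKappa σ i (D₁·S_F(M))` (`finsum` over the image of the injective coset map `D₁ ↦ D₁·S_F(M)`, ★ `polarisationCosets_eq_image_of_reps`).
[cite: Kottwitz1986BaseChangeUnits, §1 pp. 240–241] [cite: Rogawski1990, §4.9 Prop. 4.9.1 (a) p. 55] -/
theorem kappaCount_eq_sum_cosetKappa_of_reps {σ : K →+* K} {ϖ : K} {tv : ℕ} {M : Submodule 𝒪[K] (Fin 3 → K)} (i : Fin 3) (reps : Finset (Fin 3 → K))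
    (hrepsfix : ∀ D ∈ reps, ∀ j, σ (D j) = D j ∧ D j ≠ 0)
    (hΔ : ∀ D : Fin 3 → K, (∀ j, σ (D j) = D j ∧ D j ≠ 0) →
      (IsVertexLattice σ ϖ (Matrix.diagonal D) tv M ↔ ∃ D₁ ∈ reps, ∃ u ∈ fixedUnitStabilizer σ M, ∀ j, D j = D₁ j * (u j : K)))
    (hfree : ∀ D₁ ∈ reps, ∀ D₂ ∈ reps, ∀ u ∈ fixedUnitStabilizer σ M, (∀ j, D₂ j = D₁ j * (u j : K)) → D₁ = D₂) :
    kappaCount σ ϖ tv i M = ∑ D₁ ∈ reps, cosetKappa σ i {D' : Fin 3 → K | ∃ u ∈ fixedUnitStabilizer σ M, ∀ j, D' j = D₁ j * ((u j : Kˣ) : K)} := by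
  classical
  -- the coset map is injective on `reps`
  have hinj : Set.InjOn (fun D₁ : Fin 3 → K => {D' : Fin 3 → K | ∃ u ∈ fixedUnitStabilizer σ M, ∀ j, D' j = D₁ j * ((u j : Kˣ) : K)})
      (reps : Set (Fin 3 → K)) := by
    rintro D₁ hD₁ D₂ hD₂ h
    have h' : {D' : Fin 3 → K | ∃ u ∈ fixedUnitStabilizer σ M, ∀ j, D' j = D₁ j * ((u j : Kˣ) : K)} =
        {D' : Fin 3 → K | ∃ u ∈ fixedUnitStabilizer σ M, ∀ j, D' j = D₂ j * ((u j : Kˣ) : K)} := h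
    have hmem : D₂ ∈ {D' : Fin 3 → K | ∃ u ∈ fixedUnitStabilizer σ M, ∀ j, D' j = D₁ j * ((u j : Kˣ) : K)} := by
      rw [h']; exact mem_coset_self σ M D₂
    obtain ⟨u, hu, hD₂u⟩ := hmem
    exact hfree D₁ hD₁ D₂ hD₂ u hu hD₂u
  rw [kappaCount_eq, polarisationCosets_eq_image_of_reps reps hrepsfix hΔ, finsum_mem_image hinj, finsum_mem_coe_finset]

end Generic

/-! ## §1  The ω- and χ-tables of the explicit type-2 polarisation `D(φ)` at the exact invariant `y″ = f·xζ` -/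

/-- **`D₀(φ) = P·Nx·h̃(φ)`** — the first entry of ★ `explicit_polarisation`'s form at `y″ = f·(xζ)` (`f` fixed, `φ ≠ 0`), with `h̃(φ) = (φ − fNζ(2+f)) − (fNζ − φ)²∕φ`, `N = (·)σ(·)`:
`B_φ = σx(fNζ − φ)`, `B′_φ = x(fNζ − φ)`, `Ny = NxNζ(1+f)²`. [cite: Jacobowitz1962, §7] [cite: Kottwitz1986BaseChangeUnits, §1 pp. 240–241] -/
theorem explicit_polarisation_fst_eq {σ : K →+* K} {x ζ f φ P gg D₁ D₀ : K} (hφ : φ ≠ 0) (hσf : σ f = f)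
    (hgg : gg = -((ζ * σ (f * (x * ζ)) - σ x * φ) * (σ ζ * (f * (x * ζ)) - x * φ)) / φ)
    (hD₁ : D₁ = -(P * (ζ * σ ζ + φ))) (hD₀ : D₀ = P * gg - (σ x * D₁ * x + σ (x * ζ + f * (x * ζ)) * P * (x * ζ + f * (x * ζ)))) :
    D₀ = P * (x * σ x) * (φ - f * (ζ * σ ζ) * (2 + f) - (f * (ζ * σ ζ) - φ) ^ 2 / φ) := by
  rw [hD₀, hgg, hD₁]
  simp only [map_mul, map_add, hσf]
  field_simp
  ring

/-- **THE ω-TABLE OF `D(φ)`** at `y″ = f·(xζ)`: `ω(P) = 1` (`P = N(ϖ^{−ρ})`), `ω(D₁(φ)) = ω(−(Nζ + φ))`, `ω(D₀(φ)) = ω(h̃(φ))` (`P·Nx = N(x·ϖ^{−ρ})`; norms do not change `ω`, ★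
`normSign_mul_norm`). [cite: Rogawski1990, §4.10 p. 58] [cite: Serre1979, Ch. V §3] -/
theorem normSign_explicit_polarisation_two {σ : K →+* K} {ϖ : K} (hϖ0 : ϖ ≠ 0) (ρ : ℕ)
    {x ζ f φ P gg D₁ D₀ : K} (hx0 : x ≠ 0) (hφ : φ ≠ 0) (hσf : σ f = f) (hP : P = ((ϖ * σ ϖ) ^ ρ)⁻¹)
    (hgg : gg = -((ζ * σ (f * (x * ζ)) - σ x * φ) * (σ ζ * (f * (x * ζ)) - x * φ)) / φ)
    (hD₁ : D₁ = -(P * (ζ * σ ζ + φ))) (hD₀ : D₀ = P * gg - (σ x * D₁ * x + σ (x * ζ + f * (x * ζ)) * P * (x * ζ + f * (x * ζ)))) :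
    normSign σ P = 1 ∧ normSign σ D₁ = normSign σ (-(ζ * σ ζ + φ)) ∧
      normSign σ D₀ = normSign σ (φ - f * (ζ * σ ζ) * (2 + f) - (f * (ζ * σ ζ) - φ) ^ 2 / φ) := by
  set z : K := (ϖ ^ ρ)⁻¹ with hz
  have hz0 : z ≠ 0 := inv_ne_zero (pow_ne_zero _ hϖ0)
  have hPz : P = z * σ z := by rw [hP, hz, map_inv₀, map_pow, mul_pow, mul_inv]
  refine ⟨?_, ?_, ?_⟩
  · rw [hPz]; unfold normSign; rw [if_pos ⟨z, rfl⟩]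
  · rw [hD₁, hPz, show -(z * σ z * (ζ * σ ζ + φ)) = -(ζ * σ ζ + φ) * (z * σ z) by ring]
    exact normSign_mul_norm σ _ hz0
  · set H : K := φ - f * (ζ * σ ζ) * (2 + f) - (f * (ζ * σ ζ) - φ) ^ 2 / φ with hH
    rw [explicit_polarisation_fst_eq hφ hσf hgg hD₁ hD₀, ← hH, hPz,
      show z * σ z * (x * σ x) * H = H * ((x * z) * σ (x * z)) by rw [map_mul]; ring]
    exact normSign_mul_norm σ _ (mul_ne_zero hx0 hz0)

/-- **THE χ-TABLE OF `D(φ)`** at `y″ = f·(xζ)`: `(χ_0, χ_1, χ_2)(D₀(φ), D₁(φ), P) = (ω(−(Nζ+φ)), ω(h̃ φ), ω(h̃ φ)·ω(−(Nζ+φ)))` (`χ_i = Π_{j ≠ i} ω`, `ω(P) = 1`).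
[cite: Rogawski1990, §4.10 p. 58] [cite: LanglandsShelstad1987, §3] -/
theorem chiVec_explicit_polarisation_two {σ : K →+* K} {ϖ : K} (hϖ0 : ϖ ≠ 0) (ρ : ℕ)
    {x ζ f φ P gg D₁ D₀ : K} (hx0 : x ≠ 0) (hφ : φ ≠ 0) (hσf : σ f = f) (hP : P = ((ϖ * σ ϖ) ^ ρ)⁻¹)
    (hgg : gg = -((ζ * σ (f * (x * ζ)) - σ x * φ) * (σ ζ * (f * (x * ζ)) - x * φ)) / φ)
    (hD₁ : D₁ = -(P * (ζ * σ ζ + φ))) (hD₀ : D₀ = P * gg - (σ x * D₁ * x + σ (x * ζ + f * (x * ζ)) * P * (x * ζ + f * (x * ζ)))) (i : Fin 3) :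
    chiVec σ i ![D₀, D₁, P] =
      (![normSign σ (-(ζ * σ ζ + φ)), normSign σ (φ - f * (ζ * σ ζ) * (2 + f) - (f * (ζ * σ ζ) - φ) ^ 2 / φ),
         normSign σ (φ - f * (ζ * σ ζ) * (2 + f) - (f * (ζ * σ ζ) - φ) ^ 2 / φ) * normSign σ (-(ζ * σ ζ + φ))] : Fin 3 → ℤ) i := by
  obtain ⟨hωP, hω1, hω0⟩ := normSign_explicit_polarisation_two hϖ0 ρ hx0 hφ hσf hP hgg hD₁ hD₀
  rw [chiVec_eq]
  fin_cases i
  · simp only [Fin.zero_eta, Fin.isValue, cons_val_zero, cons_val_one, cons_val_two, Nat.succ_eq_add_one, Nat.reduceAdd, tail_cons, head_cons]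
    rw [hω1, hωP, mul_one]
  · simp only [Fin.mk_one, Fin.isValue, cons_val_zero, cons_val_one, cons_val_two, Nat.succ_eq_add_one, Nat.reduceAdd, tail_cons, head_cons]
    rw [hω0, hωP, mul_one]
  · simp only [Fin.reduceFinMk, Fin.isValue, cons_val_zero, cons_val_one, cons_val_two, Nat.succ_eq_add_one, Nat.reduceAdd, tail_cons, head_cons]
    rw [hω0, hω1]

section NearLetters

variable [Valued K ℤᵐ⁰]

/-- **NEAR LETTERS OF THE TABLE ENTRIES** for a unit `φ` with `|φ − fNζ| ≤ |ϖ|^ρ` (`ρ ≥ 1`; `f, ζ` units, `|ϖ| ≤ 1`): (a) `−(Nζ+φ) − (−Nζ(1+f)) = −(φ − fNζ)`;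
(b) `h(φ) − (−fNζ(1+f)) = φ − fNζ` for `h(φ) = φ − fNζ(2+f)`; (c) `|h̃(φ) − h(φ)| ≤ |ϖ|^{2ρ}` (`h̃ − h = −(fNζ−φ)²∕φ`); (d) `|h̃(φ) − (−fNζ(1+f))| ≤ |ϖ|^ρ`.
[cite: Serre1979, Ch. IV §2 Prop. 6] [cite: Kottwitz1986BaseChangeUnits, §1 pp. 240–241] -/
theorem near_letters_table {σ : K →+* K} {ϖ : K} (hϖ1 : Valued.v ϖ ≤ 1) {ρ : ℕ} {ζ f φ : K} (hφ : Valued.v φ = 1)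
    (hnear : Valued.v (φ - f * (ζ * σ ζ)) ≤ Valued.v ϖ ^ ρ) :
    -(ζ * σ ζ + φ) - -(ζ * σ ζ * (1 + f)) = -(φ - f * (ζ * σ ζ)) ∧
    (φ - f * (ζ * σ ζ) * (2 + f)) - -(f * (ζ * σ ζ) * (1 + f)) = φ - f * (ζ * σ ζ) ∧
    Valued.v ((φ - f * (ζ * σ ζ) * (2 + f) - (f * (ζ * σ ζ) - φ) ^ 2 / φ) - (φ - f * (ζ * σ ζ) * (2 + f))) ≤ Valued.v ϖ ^ (2 * ρ) ∧
    Valued.v ((φ - f * (ζ * σ ζ) * (2 + f) - (f * (ζ * σ ζ) - φ) ^ 2 / φ) - -(f * (ζ * σ ζ) * (1 + f))) ≤ Valued.v ϖ ^ ρ := by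
  have hsq : Valued.v ((f * (ζ * σ ζ) - φ) ^ 2 / φ) ≤ Valued.v ϖ ^ (2 * ρ) := by
    rw [map_div₀, hφ, div_one, map_pow, Valuation.map_sub_swap, pow_mul, pow_right_comm]
    exact pow_le_pow_left₀ zero_le hnear 2
  have h2ρ : Valued.v ϖ ^ (2 * ρ) ≤ Valued.v ϖ ^ ρ := pow_le_pow_right_of_le_one' hϖ1 (by omega)
  refine ⟨by ring, by ring, ?_, ?_⟩
  · rw [show (φ - f * (ζ * σ ζ) * (2 + f) - (f * (ζ * σ ζ) - φ) ^ 2 / φ) - (φ - f * (ζ * σ ζ) * (2 + f)) = -((f * (ζ * σ ζ) - φ) ^ 2 / φ) by ring,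
      Valuation.map_neg]
    exact hsq
  · rw [show (φ - f * (ζ * σ ζ) * (2 + f) - (f * (ζ * σ ζ) - φ) ^ 2 / φ) - -(f * (ζ * σ ζ) * (1 + f)) = (φ - f * (ζ * σ ζ)) + -((f * (ζ * σ ζ) - φ) ^ 2 / φ) by ring]
    exact (Valuation.map_add _ _ _).trans (max_le hnear (by rw [Valuation.map_neg]; exact hsq.trans h2ρ))

end NearLetters

/-! ## §2  The enumeration: `kappaCount` of the type-2 core-hanging frame lattice as a sum over the `n₂(ρ)` classes -/

section Enumeration

variable [Valued K ℤᵐ⁰]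

/-- **`kappaCount σ ϖ 2 i (latt V₂) = Σ_{φ ∈ R₀} cosetKappa σ i (D(φ)·S_F)`** — ★ (iii)₂(b) `polarisationCount_two_latt_coreHanging_eq`'s enumeration RE-RUN with the κ-sign in place of
`1`: ramified quadratic datum letters `hσ hvσ hfix hϖ`, the wild trace bound `hTr`, `ρ ≥ 1`, units `x, ζ, y″, xζ+y″`, `V₂ = (1 0 0; x ϖ^ρ 0; xζ+y″ ϖ^ρζ ϖ^{2ρ+1})`, a fixed `f₀` with
(R) `|ζσy″ − σx·f₀| ≤ |ϖ|^ρ` (`f₀` need not be fixed), a finite complete irredundant system `R` of fixed units modulo `𝔭^{ρ+1}` (`hR1 hR2 hR3`, ★ `exists_fixed_class_representatives … (ρ+1) 0`), and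
`P = (ϖσϖ)^{−ρ}`; the sum runs over `R₀ = {φ ∈ R : |φ − f₀| ≤ |ϖ|^ρ}` and the summand is the κ-sign of the class of `D(φ) = (D₀(φ), D₁(φ), P)` (★ `explicit_polarisation`).
Assembly: §0 `kappaCount_eq_sum_cosetKappa_of_reps` on `reps = D '' R₀` with (iii)₂(b)'s `hΔ`∕`hfree` (★ (ii)₂ `exists_mem_fixedUnitStabilizer_iff_v_sub_le`: related ⟺ letters agree
modulo `𝔭^{ρ+1}`; `D` is injective on `R₀` by its second entry). [cite: Kottwitz1986BaseChangeUnits, §1 pp. 240–241] [cite: Serre1979, Ch. IV §2 Prop. 6] -/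
theorem kappaCount_two_latt_coreHanging_eq_sum_cosetKappa {σ : K →+* K} {ϖ : K} (hσ : ∀ a, σ (σ a) = a) (hvσ : ∀ a, Valued.v (σ a) = Valued.v a)
    (hfix : ∀ x : K, σ x = x → x ≠ 0 → ∃ n : ℤ, Valued.v x = WithZero.exp (2 * n)) (hϖ : Valued.v ϖ = WithZero.exp (-1 : ℤ))
    (hTr : ∀ a : K, Valued.v (a + σ a) ≤ Valued.v ϖ * Valued.v a)
    (ρ : ℕ) (hρ : 1 ≤ ρ) {x ζ y'' : K} (hx : Valued.v x = 1) (hζ : Valued.v ζ = 1) (hy'' : Valued.v y'' = 1) (hy : Valued.v (x * ζ + y'') = 1)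
    (V : GL (Fin 3) K) (hV : (V : Matrix (Fin 3) (Fin 3) K) = !![1, 0, 0; x, ϖ ^ ρ, 0; x * ζ + y'', ϖ ^ ρ * ζ, ϖ ^ (2 * ρ + 1)])
    {f₀ : K} (hR₀ : Valued.v (ζ * σ y'' - σ x * f₀) ≤ Valued.v ϖ ^ ρ)
    {R : Set K} (hRfin : R.Finite) (hR1 : ∀ g ∈ R, σ g = g ∧ Valued.v g = 1)
    (hR2 : ∀ f : K, σ f = f → Valued.v f = 1 → ∃ g ∈ R, Valued.v (f - g) ≤ Valued.v ϖ ^ (ρ + 1))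
    (hR3 : ∀ g ∈ R, ∀ g' ∈ R, Valued.v (g - g') ≤ Valued.v ϖ ^ (ρ + 1) → g = g')
    {P : K} (hP : P = ((ϖ * σ ϖ) ^ ρ)⁻¹) (i : Fin 3) :
    kappaCount σ ϖ 2 i (latt (V : Matrix (Fin 3) (Fin 3) K)) =
      ∑ᶠ φ ∈ {φ ∈ R | Valued.v (φ - f₀) ≤ Valued.v ϖ ^ ρ},
        cosetKappa σ i {D' : Fin 3 → K | ∃ u ∈ fixedUnitStabilizer σ (latt (V : Matrix (Fin 3) (Fin 3) K)), ∀ j, D' j =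
          (![P * (-((ζ * σ y'' - σ x * φ) * (σ ζ * y'' - x * φ)) / φ) - (σ x * (-(P * (ζ * σ ζ + φ))) * x + σ (x * ζ + y'') * P * (x * ζ + y'')),
             -(P * (ζ * σ ζ + φ)), P] : Fin 3 → K) j * ((u j : Kˣ) : K)} := by
  classical
  obtain ⟨hϖ0, hϖ1⟩ := ne_zero_and_v_lt_one_of_v_eq_exp hϖ
  have hϖρ1 : Valued.v ϖ ^ ρ < 1 := pow_lt_one₀ zero_le hϖ1 (by omega)
  have hϖle : Valued.v ϖ ^ (ρ + 1) ≤ Valued.v ϖ ^ ρ := pow_le_pow_right_of_le_one' hϖ1.le (by omega)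
  set y : K := x * ζ + y'' with hydef
  set Nζ : K := ζ * σ ζ with hNζ
  -- `|φ| = 1` for every `φ` with (R); `|f₀| = 1`
  have h1 : Valued.v (ζ * σ y'') = 1 := by rw [map_mul, hζ, hvσ, hy'', one_mul]
  have hunit : ∀ {φ : K}, Valued.v (ζ * σ y'' - σ x * φ) ≤ Valued.v ϖ ^ ρ → Valued.v φ = 1 := fun {φ} hφ => by
    have hvxf : Valued.v (σ x * φ) = 1 := by
      have e : σ x * φ = ζ * σ y'' + -(ζ * σ y'' - σ x * φ) := by ring
      rw [e, Valuation.map_add_eq_of_lt_left _ (by rw [Valuation.map_neg, h1]; exact hφ.trans_lt hϖρ1), h1]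
    rw [map_mul, hvσ, hx, one_mul] at hvxf; exact hvxf
  -- (R) transfers along `|φ − f₀| ≤ |ϖ|^ρ`, and conversely
  have hRdiff : ∀ φ : K, ζ * σ y'' - σ x * φ = (ζ * σ y'' - σ x * f₀) + σ x * (f₀ - φ) := fun φ => by ring
  have hR_of_near : ∀ {φ : K}, Valued.v (φ - f₀) ≤ Valued.v ϖ ^ ρ → Valued.v (ζ * σ y'' - σ x * φ) ≤ Valued.v ϖ ^ ρ := fun {φ} hφ => by
    rw [hRdiff φ]
    refine (Valuation.map_add _ _ _).trans (max_le hR₀ ?_)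
    rw [map_mul, hvσ, hx, one_mul, Valuation.map_sub_swap]; exact hφ
  have hnear_of_R : ∀ {φ : K}, Valued.v (ζ * σ y'' - σ x * φ) ≤ Valued.v ϖ ^ ρ → Valued.v (φ - f₀) ≤ Valued.v ϖ ^ ρ := fun {φ} hφ => by
    have e : φ - f₀ = (σ x)⁻¹ * ((ζ * σ y'' - σ x * f₀) - (ζ * σ y'' - σ x * φ)) := by
      have hσx0 : σ x ≠ 0 := fun h0 => by have := hvσ x; rw [h0, map_zero, hx] at this; exact zero_ne_one this
      field_simp; ring
    rw [e, map_mul, map_inv₀, hvσ, hx, inv_one, one_mul]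
    exact v_sub_le_of_le hR₀ hφ
  -- the class of `f₀` inside `R`
  set R₀ : Set K := {g ∈ R | Valued.v (g - f₀) ≤ Valued.v ϖ ^ ρ} with hR₀def
  have hR₀fin : R₀.Finite := hRfin.subset (Set.sep_subset _ _)
  -- the explicit forms
  have hP0 : P ≠ 0 := by
    rw [hP]; refine inv_ne_zero (pow_ne_zero _ (mul_ne_zero hϖ0 fun h => hϖ0 ?_)); rw [← hσ ϖ, h, map_zero]
  let Dm : K → Fin 3 → K := fun g =>
    ![P * (-((ζ * σ y'' - σ x * g) * (σ ζ * y'' - x * g)) / g) - (σ x * (-(P * (Nζ + g))) * x + σ y * P * y), -(P * (Nζ + g)), P]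
  have hDm1 : ∀ g, Dm g 1 = -(P * (Nζ + g)) := fun _ => rfl
  have hDm2 : ∀ g, Dm g 2 = P := fun _ => rfl
  have hratioDm : ∀ g, Dm g 1 / Dm g 2 = -(Nζ + g) := fun g => by rw [hDm1, hDm2]; field_simp
  have hform : ∀ g : K, σ g = g → Valued.v (ζ * σ y'' - σ x * g) ≤ Valued.v ϖ ^ ρ →
      (∀ j, σ (Dm g j) = Dm g j ∧ Dm g j ≠ 0) ∧ IsVertexLattice σ ϖ (Matrix.diagonal (Dm g)) 2 (latt (V : Matrix (Fin 3) (Fin 3) K)) :=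
    fun g hg hRg => explicit_polarisation hσ hvσ hϖ0 hϖ1 hTr ρ hρ hx hζ hy'' hy V hV hg hRg hP rfl rfl rfl
  -- the letter `f_D` of a polarisation and its ratio
  have hletter : ∀ {D : Fin 3 → K}, (∀ j, σ (D j) = D j ∧ D j ≠ 0) → IsVertexLattice σ ϖ (Matrix.diagonal D) 2 (latt (V : Matrix (Fin 3) (Fin 3) K)) →
      σ (-(D 1 + D 2 * Nζ) / D 2) = -(D 1 + D 2 * Nζ) / D 2 ∧ Valued.v (ζ * σ y'' - σ x * (-(D 1 + D 2 * Nζ) / D 2)) ≤ Valued.v ϖ ^ ρ ∧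
        D 1 / D 2 = -(Nζ + -(D 1 + D 2 * Nζ) / D 2) := fun {D} hD hvert => by
    obtain ⟨hσf, -, -, hR, -⟩ := letters_and_v_of_mem_Delta2 hσ hvσ hfix hϖ hTr ρ hρ hx hζ hy'' hy V hV hD hvert rfl rfl
    refine ⟨hσf, hR, ?_⟩
    have hD2 : D 2 ≠ 0 := (hD 2).2
    field_simp; ring
  -- the representative set
  let reps : Finset (Fin 3 → K) := hR₀fin.toFinset.image Dm
  have hmem_reps : ∀ {D₁ : Fin 3 → K}, D₁ ∈ reps ↔ ∃ g ∈ R₀, Dm g = D₁ := fun {D₁} => by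
    simp only [reps, Finset.mem_image, Set.Finite.mem_toFinset]
  have hinj : Set.InjOn Dm R₀ := fun g _ g' _ h => by
    have h1 := congrFun h 1
    rw [hDm1, hDm1, neg_inj] at h1
    exact add_left_cancel (mul_left_cancel₀ hP0 h1)
  have hrepsfix : ∀ D₁ ∈ reps, ∀ j, σ (D₁ j) = D₁ j ∧ D₁ j ≠ 0 := fun D₁ hD₁ => by
    obtain ⟨g, hg, rfl⟩ := hmem_reps.1 hD₁
    exact (hform g (hR1 g hg.1).1 (hR_of_near hg.2)).1
  have hΔ : ∀ D : Fin 3 → K, (∀ j, σ (D j) = D j ∧ D j ≠ 0) →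
      (IsVertexLattice σ ϖ (Matrix.diagonal D) 2 (latt (V : Matrix (Fin 3) (Fin 3) K)) ↔
        ∃ D₁ ∈ reps, ∃ u ∈ fixedUnitStabilizer σ (latt (V : Matrix (Fin 3) (Fin 3) K)), ∀ j, D j = D₁ j * (u j : K)) := fun D hD => by
    refine ⟨fun hvert => ?_, ?_⟩
    · -- relate `D` to the form of the representative of its letter
      obtain ⟨hσf, hRf, hratio⟩ := hletter hD hvert
      set f : K := -(D 1 + D 2 * Nζ) / D 2 with hf
      have hvf : Valued.v f = 1 := hunit hRf
      obtain ⟨g, hgR, hfg⟩ := hR2 f hσf hvf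
      have hg₀ : g ∈ R₀ := by
        refine ⟨hgR, ?_⟩
        have e : g - f₀ = (f - f₀) + -(f - g) := by ring
        rw [e]
        exact (Valuation.map_add _ _ _).trans (max_le (hnear_of_R hRf) (by rw [Valuation.map_neg]; exact hfg.trans hϖle))
      obtain ⟨hDg, hvertg⟩ := hform g (hR1 g hgR).1 (hR_of_near hg₀.2)
      have hrel : Valued.v (Dm g 1 / Dm g 2 - D 1 / D 2) ≤ Valued.v ϖ ^ (ρ + 1) := by
        rw [hratioDm, hratio, show -(Nζ + g) - -(Nζ + f) = f - g by ring]; exact hfg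
      obtain ⟨u, hu, hDu⟩ := (exists_mem_fixedUnitStabilizer_iff_v_sub_le hσ hvσ hfix hϖ hTr ρ hρ hx hζ hy'' hy V hV hDg hvertg hD hvert).2 hrel
      exact ⟨Dm g, hmem_reps.2 ⟨g, hg₀, rfl⟩, u, hu, hDu⟩
    · -- cosets of polarisations are polarisations
      rintro ⟨D₁, hD₁, u, hu, hDu⟩
      obtain ⟨g, hg, rfl⟩ := hmem_reps.1 hD₁
      have hfun : (fun j => Dm g j * (u j : K)) = D := funext fun j => (hDu j).symm
      exact hfun ▸ isVertexLattice_diagonal_mul_of_mem_fixedUnitStabilizer σ (hform g (hR1 g hg.1).1 (hR_of_near hg.2)).2 hu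
  have hfree : ∀ D₁ ∈ reps, ∀ D₂ ∈ reps, ∀ u ∈ fixedUnitStabilizer σ (latt (V : Matrix (Fin 3) (Fin 3) K)), (∀ j, D₂ j = D₁ j * (u j : K)) → D₁ = D₂ := by
    intro D₁ hD₁ D₂ hD₂ u hu hDu
    obtain ⟨g, hg, rfl⟩ := hmem_reps.1 hD₁
    obtain ⟨g', hg', rfl⟩ := hmem_reps.1 hD₂
    obtain ⟨hDg, hvertg⟩ := hform g (hR1 g hg.1).1 (hR_of_near hg.2)
    obtain ⟨hDg', hvertg'⟩ := hform g' (hR1 g' hg'.1).1 (hR_of_near hg'.2)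
    have hrel := (exists_mem_fixedUnitStabilizer_iff_v_sub_le hσ hvσ hfix hϖ hTr ρ hρ hx hζ hy'' hy V hV hDg hvertg hDg' hvertg').1 ⟨u, hu, hDu⟩
    rw [hratioDm, hratioDm, show -(Nζ + g) - -(Nζ + g') = g' - g by ring] at hrel
    rw [hR3 g' hg'.1 g hg.1 hrel]
  -- assemble: `kappaCount = Σ_{reps} cosetKappa = Σ_{φ ∈ R₀} cosetKappa (Dm φ · S_F)`
  rw [kappaCount_eq_sum_cosetKappa_of_reps i reps hrepsfix hΔ hfree, Finset.sum_image (fun g hg g' hg' h => hinj (by simpa using hg) (by simpa using hg') h),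
    finsum_mem_eq_finite_toFinset_sum _ hR₀fin]

/-- **ALIVE WINDOW, EXACT INVARIANT: `kappaCount σ ϖ 2 i (latt V₂) = Σᶠ_{φ ∈ R₀} (ω(−(Nζ+φ)), ω(h̃ φ), ω(h̃ φ)·ω(−(Nζ+φ)))_i`** — the previous enumeration at `y″ = f·(xζ)` (`f` a
fixed unit, `|1+f| = 1`; centre `f₀ = f·Nζ`, so `R₀ = {φ ∈ R : |φ − fNζ| ≤ |ϖ|^ρ}`), when `χ_i ≡ 1` on `S_F(latt V₂)` (then each class contributes the sign `χ_i(D(φ))` of its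
representative, ★ Fκ2 `cosetKappa_coset_eq_of_forall`, read off the §1 χ-table).  FILE (A2₂) sums the table by regime. [cite: Kottwitz1986BaseChangeUnits, §1 pp. 240–241]
[cite: LanglandsShelstad1987, §3] [cite: Rogawski1990, §4.10 p. 58] -/
theorem kappaCount_two_latt_coreHanging_eq_finsum_table {σ : K →+* K} {ϖ : K} (hσ : ∀ a, σ (σ a) = a) (hvσ : ∀ a, Valued.v (σ a) = Valued.v a)
    (hfix : ∀ x : K, σ x = x → x ≠ 0 → ∃ n : ℤ, Valued.v x = WithZero.exp (2 * n)) (hϖ : Valued.v ϖ = WithZero.exp (-1 : ℤ))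
    (hTr : ∀ a : K, Valued.v (a + σ a) ≤ Valued.v ϖ * Valued.v a)
    {c : K} (hσc : σ c = c) (hc : ¬ ∃ z : K, z * σ z = c) (hdich : ∀ s : K, σ s = s → s ≠ 0 → (∃ z : K, z * σ z = s) ∨ ∃ z : K, z * σ z = c * s)
    (ρ : ℕ) (hρ : 1 ≤ ρ) {x ζ f : K} (hx : Valued.v x = 1) (hζ : Valued.v ζ = 1) (hσf : σ f = f) (hf : Valued.v f = 1) (h1f : Valued.v (1 + f) = 1)
    (V : GL (Fin 3) K) (hV : (V : Matrix (Fin 3) (Fin 3) K) = !![1, 0, 0; x, ϖ ^ ρ, 0; x * ζ + f * (x * ζ), ϖ ^ ρ * ζ, ϖ ^ (2 * ρ + 1)])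
    {R : Set K} (hRfin : R.Finite) (hR1 : ∀ g ∈ R, σ g = g ∧ Valued.v g = 1)
    (hR2 : ∀ f' : K, σ f' = f' → Valued.v f' = 1 → ∃ g ∈ R, Valued.v (f' - g) ≤ Valued.v ϖ ^ (ρ + 1))
    (hR3 : ∀ g ∈ R, ∀ g' ∈ R, Valued.v (g - g') ≤ Valued.v ϖ ^ (ρ + 1) → g = g') (i : Fin 3)
    (halive : ∀ u ∈ fixedUnitStabilizer σ (latt (V : Matrix (Fin 3) (Fin 3) K)), chiVec σ i (fun j => ((u j : Kˣ) : K)) = 1) :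
    kappaCount σ ϖ 2 i (latt (V : Matrix (Fin 3) (Fin 3) K)) =
      ∑ᶠ φ ∈ {φ ∈ R | Valued.v (φ - f * (ζ * σ ζ)) ≤ Valued.v ϖ ^ ρ},
        (![normSign σ (-(ζ * σ ζ + φ)), normSign σ (φ - f * (ζ * σ ζ) * (2 + f) - (f * (ζ * σ ζ) - φ) ^ 2 / φ),
           normSign σ (φ - f * (ζ * σ ζ) * (2 + f) - (f * (ζ * σ ζ) - φ) ^ 2 / φ) * normSign σ (-(ζ * σ ζ + φ))] : Fin 3 → ℤ) i := by
  obtain ⟨hϖ0, hϖ1⟩ := ne_zero_and_v_lt_one_of_v_eq_exp hϖ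
  have hϖρ1 : Valued.v ϖ ^ ρ < 1 := pow_lt_one₀ zero_le hϖ1 (by omega)
  have hx0 : x ≠ 0 := fun h => by rw [h, map_zero] at hx; exact zero_ne_one hx
  -- the unit letters of the frame at the exact invariant
  have hy''1 : Valued.v (f * (x * ζ)) = 1 := by rw [map_mul, map_mul, hf, hx, hζ, one_mul, one_mul]
  have hy1 : Valued.v (x * ζ + f * (x * ζ)) = 1 := by
    rw [show x * ζ + f * (x * ζ) = x * ζ * (1 + f) by ring, map_mul, map_mul, hx, hζ, h1f, one_mul, one_mul]
  have hR₀ : Valued.v (ζ * σ (f * (x * ζ)) - σ x * (f * (ζ * σ ζ))) ≤ Valued.v ϖ ^ ρ := by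
    rw [show ζ * σ (f * (x * ζ)) - σ x * (f * (ζ * σ ζ)) = 0 by rw [map_mul, map_mul, hσf]; ring, map_zero]; exact zero_le
  rw [kappaCount_two_latt_coreHanging_eq_sum_cosetKappa hσ hvσ hfix hϖ hTr ρ hρ hx hζ hy''1 hy1 V hV hR₀ hRfin hR1 hR2 hR3 rfl i]
  refine finsum_mem_congr rfl fun φ hφ => ?_
  obtain ⟨hφR, hφnear⟩ := hφ
  obtain ⟨hσφ, hvφ⟩ := hR1 φ hφR
  have hφ0 : φ ≠ 0 := fun h => by rw [h, map_zero] at hvφ; exact zero_ne_one hvφ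
  -- (R) at `φ`
  have hRφ : Valued.v (ζ * σ (f * (x * ζ)) - σ x * φ) ≤ Valued.v ϖ ^ ρ := by
    rw [show ζ * σ (f * (x * ζ)) - σ x * φ = σ x * (f * (ζ * σ ζ) - φ) by rw [map_mul, map_mul, hσf]; ring, map_mul, hvσ, hx, one_mul,
      Valuation.map_sub_swap]
    exact hφnear
  obtain ⟨hDφ, -⟩ := explicit_polarisation hσ hvσ hϖ0 hϖ1 hTr ρ hρ hx hζ hy''1 hy1 V hV hσφ hRφ (P := ((ϖ * σ ϖ) ^ ρ)⁻¹) rfl rfl rfl rfl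
  rw [cosetKappa_coset_eq_of_forall σ hσc hc hdich i _ hDφ halive,
    chiVec_explicit_polarisation_two hϖ0 ρ hx0 hφ0 hσf (P := ((ϖ * σ ϖ) ^ ρ)⁻¹) rfl rfl rfl rfl i]

end Enumeration

end Summit.HodgeConjecture.HodgeConjecture.Cruxes.H413.F0P3cDyRamDiagonalKappaCoreHangingTwoForms

end
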